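import Mathlib
import Summits.Ventures.PercRepro2.CoinChainXAGateHull4Gen

/-!
# The chain at every ρ on the hull of five gates, arbitrary coin-entered set
(blind cell PercRepro2, night-2 g27; proofs/NIGHT2-DARC.md §68.14)
-/

namespace Summit.Ventures.PercRepro2.Coin

open Classical

section GateHull4GenChain

variable {V : Type*} [DecidableEq V] {R : Type*} [Field R] [LinearOrder R] [IsStrictOrderedRing R]

/-- **THE CHAIN AT EVERY ρ ON THE HULL OF FIVE GATES, ARBITRARY COIN-ENTERED SET**: the chain functional of
`chain_functional_nonneg_of_XA'` is nonnegative for every gate `d' = θ₁·d·1[{m, j} ⊆ W] + θ₂·d·1[j ∈ W] + θ₃·d·1[m ∈ W] + θ₄·d`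
(`θᵢ ≥ 0`, `Σθ ≤ 1`) satisfying the standing gate hypotheses. -/
theorem chain_functional_nonneg_six_gate_hull4_gen (U : Finset V) (m j : V) (ent' : Finset V) (hj : j ∈ ent')
    (ν c d d' : Finset V → R)
    (ρ : R) (hρ0 : 0 ≤ ρ) (hρ1 : ρ ≤ 1) (hν0 : ∀ W, 0 ≤ ν W)
    (hν : ∀ s ⊆ U, ∀ t ⊆ U, ν s * ν t ≤ ν (s ∩ t) * ν (s ∪ t))
    (hc0 : ∀ W, 0 ≤ c W) (hd0 : ∀ W, 0 ≤ d W) (hd'0 : ∀ W, 0 ≤ d' W)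
    (hdc : ∀ W, d W ≤ c W) (hd'c : ∀ W, d' W ≤ c W) (hd'd : ∀ W, d' W ≤ d W)
    (hcc : ∀ s t, c s * c t ≤ c (s ∩ t) * c (s ∪ t))
    (hdd : ∀ s t, d s * d t ≤ d (s ∩ t) * d (s ∪ t))
    (hd'd' : ∀ s t, d' s * d' t ≤ d' (s ∩ t) * d' (s ∪ t))
    (hcd : ∀ s t, c s * d t ≤ c (s ∩ t) * d (s ∪ t))
    (hcd' : ∀ s t, c s * d' t ≤ c (s ∩ t) * d' (s ∪ t))
    (hdd' : ∀ s t, d s * d' t ≤ d (s ∩ t) * d' (s ∪ t))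
    (hratio : ∀ s t, s ⊆ t → d s * c t ≤ c s * d t)
    (hratio' : ∀ s t, s ⊆ t → d' s * c t ≤ c s * d' t)
    (θ₁ θ₂ θ₃ θ₄ : R) (hθ₁ : 0 ≤ θ₁) (hθ₂ : 0 ≤ θ₂) (hθ₃ : 0 ≤ θ₃) (hθ₄ : 0 ≤ θ₄) (hθ : θ₁ + θ₂ + θ₃ + θ₄ ≤ 1)
    (hd' : ∀ W, d' W = θ₁ * (if m ∈ W ∧ j ∈ W then d W else 0) + θ₂ * (if j ∈ W then d W else 0)
      + θ₃ * (if m ∈ W then d W else 0) + θ₄ * d W)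
    (x y : Finset V → R) (hx : ∀ W, x W = if m ∈ W then 1 else 0)
    (hy : ∀ W, y W = if j ∈ W then 1 else 0)
    (hpos0 : 0 < ∑ W ∈ U.powerset, ν W * chainMix {m} ent' 0 c d W)
    (hpos1 : 0 < ∑ W ∈ U.powerset, ν W * chainMix {m} ent' 1 c d W)
    (hmI : 0 < ∑ W ∈ U.powerset.filter (fun W => ¬ ∃ r ∈ ({m} : Finset V) ∪ ent', r ∈ W), ν W * c W) :
    0 ≤ (∑ W ∈ U.powerset, ν W * chainMix {m} ent' ρ c d W) ^ 2 *
          (∑ W ∈ U.powerset, ν W * chainMix {m} ent' ρ c d' W * (x W * y W))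
        - (∑ W ∈ U.powerset, ν W * chainMix {m} ent' ρ c d W) *
          (∑ W ∈ U.powerset, ν W * chainMix {m} ent' ρ c d W * x W) *
          (∑ W ∈ U.powerset, ν W * chainMix {m} ent' ρ c d' W * y W)
        - (∑ W ∈ U.powerset, ν W * chainMix {m} ent' ρ c d W) *
          (∑ W ∈ U.powerset, ν W * chainMix {m} ent' ρ c d W * y W) *
          (∑ W ∈ U.powerset, ν W * chainMix {m} ent' ρ c d' W * x W)
        + (∑ W ∈ U.powerset, ν W * chainMix {m} ent' ρ c d W * x W) *
          (∑ W ∈ U.powerset, ν W * chainMix {m} ent' ρ c d W * y W) *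
          (∑ W ∈ U.powerset, ν W * chainMix {m} ent' ρ c d' W) :=
  chain_functional_nonneg_of_XA' U {m} ent' ν c d d' ρ hρ0 hρ1 hν0 hν hc0 hd0 hd'0 hdc hd'c hd'd
    hcc hdd hd'd' hcd hcd' hdd' hratio hratio' x y (marker_nonneg m x hx) (marker_nonneg j y hy)
    (marker_mono m x hx) (marker_mono j y hy) hpos0 hpos1 hmI
    (chain_XA'_six_gate_hull4_gen U m j ent' hj ν c d d' hν0 hν hc0 hd0 hdc hcc hdd hcd hratio θ₁ θ₂ θ₃ θ₄
      hθ₁ hθ₂ hθ₃ hθ₄ hθ hd' x y hx hy)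

end GateHull4GenChain

end Summit.Ventures.PercRepro2.Coin
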